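import Summits.Ventures.YMGap.Thresholds.CouplingSignFlipMassGap
import Summits.Ventures.YMGap.Thresholds.StarInfiniteVolume
import Summits.Ventures.YMGap.Thresholds.SharpStrongCoupling
import Summits.Ventures.YMGap.StrongCouplingGapFromCertificate
import HarnessLib

/-!
# Venture YMGap — track (c) «DS» in the cell's TARGET TYPE: `ImprovedThreshold 4 2 (9/100)`
# (the two-sided Shen–Zhu–Zhu-currency window `|β| < 9/100` for `SU(2)`, `d = 4`), hypothesis-free

HONEST FRAMING: venture file (cell `pub-ymgap`, PLAN R115(2); ds-3), strong-coupling LATTICE statement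
about the tree's DLR objects on `ℤ^4` (`MassGapAt`, `MassGapBelow`, `ImprovedThreshold` of
`StrongCouplingGapShape.lean`; `StrongCouplingPhaseAt` of `SharpStrongCoupling.lean`); nothing about the
continuum, confinement at weak coupling, a transfer-matrix gap or the Clay problem.  This file only
COMPOSES tree theorems (no re-proof): the JOIN row `DSWindowZd.su2_massGapAt_le_9_100` (ds-1,
`StarInfiniteVolume.lean`: Lemma G of ds-4 + the torus → `ℤ^4` uniqueness door of ds-1 + the clustering
capstone of ds-2), p2's phase bridge `HessianSharp.strongCouplingPhaseAt_of_massGapAt`, and ds-3's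
coupling-sign symmetry (`SignFlip.massGapAt_two_neg`, `SignFlip.improvedThreshold_two_of_nonneg`), which
supplies the negative couplings.

* ★ `su2_improvedThreshold_9_100 : ImprovedThreshold 4 2 (9/100)` — the cell's track-(a) target type,
  instantiated: `1/(16·3) = 1/48 < 9/100` and `MassGapBelow 4 2 (9/100)`, i.e. DLR uniqueness + the
  Shen–Zhu–Zhu covariance clause for every DLR state at EVERY 't Hooft coupling `|β| < 9/100`;
  `su2_massGapBelow_9_100`; `su2_massGapAt_of_abs_le` (closed form `|β| ≤ 9/100`);
* `su2_strongCouplingPhaseAt_of_abs_le` — the Sweep-1 phase predicate at every TREE coupling `|β| ≤ 9/50`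
  (negative side through uniqueness + the flip, not through the tori);
* `su2_hasUniqueGibbsMeasure_of_abs_le` — DLR uniqueness at every bare coupling `|b| ≤ 9/50`;
* `su2_dlrMassGapAt_of_abs_le` — the same window in the SC-a currency `DLRMassGapAt 4 2 β` of the tree's
  single-link fronts (`su2_dlrMassGapAt_sharp`: Wilson `β_W ≤ 1/6`; here `|β_W| ≤ 9/25`), via the tree's
  dictionary `massGapAt_iff_dlrMassGapAt`.

Comparison (same currency, 't Hooft `β`): Shen–Zhu–Zhu, CMP 400 (2023) Thm 1.2 / Cor 1.4: `|β| < 1/48`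
(`shen_zhu_zhu_iff_massGapBelow`); track (a) of this cell: `|β| < 1/32`, K-conditional on three printed
facts (`HessianSharp.improvedThreshold_dim4`); here `|β| < 9/100 = 4.32 × (1/48)`, no hypothesis.
-/

noncomputable section

open Literature.Probability.LatticeModels
open Literature.MathematicalPhysics.QuantumLattice (fundamentalRep ymSpecification)
open Literature.MathematicalPhysics.QuantumFieldTheory.Balaban1983to89.StrongCouplingDobrushinWindow
  (DLRMassGapAt)

namespace Summit.Ventures.YMGap.ImprovedThresholdStar

/-- ★ **`ImprovedThreshold 4 2 (9/100)`** — the cell's track-(a) TARGET TYPE instantiated for `SU(2)`,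
`d = 4`: `1/48 < 9/100` and `MassGapAt 4 2 β` for EVERY 't Hooft coupling `|β| < 9/100` (the JOIN row
`DSWindowZd.su2_massGapAt_le_9_100` on `[0, 9/100]`, negative couplings by the staggered centre flip,
`SignFlip.improvedThreshold_two_of_nonneg`).  No hypothesis. -/
theorem su2_improvedThreshold_9_100 : ImprovedThreshold 4 2 (9 / 100) :=
  SignFlip.improvedThreshold_two_of_nonneg (by norm_num)
    fun _ h0 h1 => DSWindowZd.su2_massGapAt_le_9_100 h0 h1

/-- **`MassGapBelow 4 2 (9/100)`**: the Shen–Zhu–Zhu-currency window (`∀ β, |β| < 9/100 → MassGapAt 4 2 β`),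
`4.32 ×` the printed `1/48`. -/
theorem su2_massGapBelow_9_100 : MassGapBelow 4 2 (9 / 100) :=
  su2_improvedThreshold_9_100.2

/-- Closed two-sided form: `MassGapAt 4 2 β` for every `|β| ≤ 9/100`. -/
theorem su2_massGapAt_of_abs_le {β : ℝ} (h : |β| ≤ 9 / 100) : MassGapAt 4 2 β := by
  rcases le_or_gt 0 β with h0 | h0
  · exact DSWindowZd.su2_massGapAt_le_9_100 h0 ((le_abs_self β).trans h)
  · have h1 : MassGapAt 4 2 (-β) :=
      DSWindowZd.su2_massGapAt_le_9_100 (by linarith) ((neg_le_abs β).trans h)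
    simpa using SignFlip.massGapAt_two_neg h1

/-- **The Sweep-1 phase predicate, two-sided**: `StrongCouplingPhaseAt 4 2 β` (full-sequence convergence
of the periodic states to a translation-invariant state, identification of every free-boundary limit,
exponential plaquette clustering) at every TREE coupling `|β| ≤ 9/50` — p2's unconditional bridge
`strongCouplingPhaseAt_of_massGapAt` fed with the two-sided `MassGapAt` row at 't Hooft coupling `β/2`. -/
theorem su2_strongCouplingPhaseAt_of_abs_le {β : ℝ} (h : |β| ≤ 9 / 50) :
    HessianSharp.StrongCouplingPhaseAt 4 2 β := by
  have hm : MassGapAt 4 2 (β / 2) := su2_massGapAt_of_abs_le (by rw [abs_div, abs_two]; linarith)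
  exact HessianSharp.strongCouplingPhaseAt_of_massGapAt (N := 2) (d := 4) (by norm_num) (by norm_num)
    (by exact_mod_cast hm)

/-- **Two-sided DLR uniqueness** of the infinite-volume `SU(2)` Wilson state on `ℤ^4` at every bare
coupling `|b| ≤ 9/50` (Wilson `|β_W| ≤ 9/25`). -/
theorem su2_hasUniqueGibbsMeasure_of_abs_le {b : ℝ} (h : |b| ≤ 9 / 50) :
    HasUniqueGibbsMeasure (ymSpecification (d := 4) (fundamentalRep (Fin 2)) b) := by
  have hm := su2_massGapAt_of_abs_le (β := b / 2) (by rw [abs_div, abs_two]; linarith)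
  obtain ⟨hu, -⟩ := hm
  have e : ((2 : ℕ) : ℝ) * (b / 2) = b := by push_cast; ring
  rwa [e] at hu

/-- **The same window in the SC-a currency `DLRMassGapAt`** (uniqueness and ONE clustering rate for all DLR
states; the currency of the tree's single-link fronts `su2_dlrMassGapAt_sharp` / `su2_dlrMassGapAt_of_le`,
Wilson `β_W ≤ 1/6`-class): `DLRMassGapAt 4 2 β` at every 't Hooft coupling `|β| ≤ 9/100` (Wilson
`|β_W| ≤ 9/25`), through the tree's dictionary `massGapAt_iff_dlrMassGapAt`. -/
theorem su2_dlrMassGapAt_of_abs_le {β : ℝ} (h : |β| ≤ 9 / 100) : DLRMassGapAt 4 2 β :=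
  massGapAt_iff_dlrMassGapAt.1 (su2_massGapAt_of_abs_le h)

end Summit.Ventures.YMGap.ImprovedThresholdStar

end
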